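import Mathlib
import HarnessLib

/-!
# Chan–Ilten 2015, Proposition 2.6: when the Fano schemes of the determinantal and permanental
# schemes are nonempty

Topic `Literature/AlgebraicGeometry/DeterminantalHypersurfaces`. Source: M. Chan, N. Ilten, *Fano schemes of
determinants and permanents*, Algebra & Number Theory 9 (2015) 629–679, arXiv:1312.2577 (held text
`paper:arxiv-1312.2577`, read this session).  Setup (p0003): "Fix an algebraically closed field `K`. For numbers
`r, m, n` with `1 < r ≤ m ≤ n`, let `D^r_{m,n}` and `P^r_{m,n}` denote the subschemes of `ℙ^{mn-1}_K` defined by the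
`r × r` determinants, respectively the `r × r` permanents, of an `m × n` matrix … Whenever we are dealing with
`P^r_{m,n}`, we will make the standard assumption that `char K ≠ 2`. … the Fano schemes `F_k(D^r_{m,n})` and
`F_k(P^r_{m,n})` … parametrizing those `k`-dimensional planes in `ℙ^{mn-1}` that are contained in the schemes";
statement (p0007 L28–29): "▶ Proposition 2.6. The Fano schemes `F_k(D^r_{m,n})` and `F_k(P^r_{m,n})` are nonempty
if and only if `k < (r-1)n`." (proof, L31–35: torus fixed points are subspaces of standard `s`-compression spaces,
`κ(0) = (r-1)m - 1`, `κ(r-1) = (r-1)n - 1`, convexity of `κ`; the determinantal case is Dieudonné's theorem.)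

Typed in the elementary K-POINT form (a nonempty scheme of finite type over `K = K̄` has a `K`-point, and a
`K`-point of `F_k(X)`, `X ⊆ ℙ(Mat_{m×n})` cut out by forms, is a `(k+1)`-dimensional linear subspace `W` of
`Mat_{m×n}(K)` on which those forms vanish identically): `W : Submodule K (Matrix (Fin m) (Fin n) K)` with
`finrank W = k + 1` on which every `r × r` minor `det (M.submatrix ρ γ)` (resp. every `r × r` sub-permanent
`Matrix.permanent (M.submatrix ρ γ)`, Mathlib's `Matrix.permanent`), `ρ : Fin r ↪ Fin m`, `γ : Fin r ↪ Fin n`,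
vanishes.  The named fact `ChanIlten.proposition26` is NOT proved here (the "only if" halves are Dieudonné /
Flanders for determinants and the Borel-fixed-point argument of §2 for permanents); the "if" halves are proved
(`ChanIlten.exists_subspace_of_lt`: matrices supported on the first `r - 1` rows, `κ(r-1) + 1 = (r-1)n`
dimensions, every `r × r` submatrix has a zero row).  Honest framing: a Literature fact adjacent to geometric
complexity theory (§1: "permanents and determinants behave completely differently"); nothing here bears on
`VP ≠ VNP` (NOT proved). [cite: ChanIlten2015, Proposition 2.6]
-/

noncomputable section

namespace Literature.AlgebraicGeometry.DeterminantalHypersurfaces.ChanIlten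

open Matrix

/-- **Chan–Ilten 2015, Proposition 2.6** (printed: "The Fano schemes `F_k(D^r_{m,n})` and `F_k(P^r_{m,n})` are
nonempty if and only if `k < (r-1)n`."), in K-point form over an algebraically closed field `K`, for
`1 < r ≤ m ≤ n`: (determinants) there is a `(k+1)`-dimensional linear subspace of `m × n` matrices on which all
`r × r` minors vanish iff `k < (r-1)·n`; (permanents, `char K ≠ 2`) the same with all `r × r` sub-permanents.
[cite: ChanIlten2015, Proposition 2.6] -/
def proposition26 : Prop :=
  ∀ (K : Type) [Field K] [IsAlgClosed K] (r m n k : ℕ), 1 < r → r ≤ m → m ≤ n →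
    ((∃ W : Submodule K (Matrix (Fin m) (Fin n) K), Module.finrank K W = k + 1 ∧
        ∀ M ∈ W, ∀ (ρ : Fin r ↪ Fin m) (γ : Fin r ↪ Fin n), (M.submatrix ρ γ).det = 0) ↔
      k < (r - 1) * n) ∧
    ((2 : K) ≠ 0 →
      ((∃ W : Submodule K (Matrix (Fin m) (Fin n) K), Module.finrank K W = k + 1 ∧
        ∀ M ∈ W, ∀ (ρ : Fin r ↪ Fin m) (γ : Fin r ↪ Fin n), (M.submatrix ρ γ).permanent = 0) ↔
      k < (r - 1) * n))

/-- A square matrix with a zero row has permanent `0` (every term of `Σ_σ Π_i A_{σ i, i}` contains an entry of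
that row). [cite: ChanIlten2015, §2 (proof of Proposition 2.6)] -/
theorem permanent_eq_zero_of_row_eq_zero {R : Type*} [CommRing R] {ι : Type*} [Fintype ι] [DecidableEq ι]
    {A : Matrix ι ι R} (a : ι) (h : ∀ j, A a j = 0) : A.permanent = 0 := by
  unfold Matrix.permanent
  refine Finset.sum_eq_zero fun σ _ => ?_
  exact Finset.prod_eq_zero (Finset.mem_univ (σ.symm a)) (by simp [h])

/-- **The "if" half of Proposition 2.6, for both schemes at once** (over any field, no hypothesis on `m, n`
beyond `r ≤ m`): if `k < (r-1)·n` then the span of `k + 1` standard basis matrices supported on the first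
`r - 1` rows is a `(k+1)`-dimensional subspace on which every `r × r` minor and every `r × r` sub-permanent
vanishes — every `r × r` submatrix along a row embedding `ρ : Fin r ↪ Fin m` has a zero row (pigeonhole).  This is
the torus fixed point "subspace of a standard `(r-1)`-compression space" of the printed proof, `κ(r-1) + 1 = (r-1)n`.
[cite: ChanIlten2015, Proposition 2.6 (proof)] -/
theorem exists_subspace_of_lt {K : Type*} [Field K] {r m n k : ℕ} (hrm : r ≤ m) (hk : k < (r - 1) * n) :
    ∃ W : Submodule K (Matrix (Fin m) (Fin n) K), Module.finrank K W = k + 1 ∧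
      ∀ M ∈ W, ∀ (ρ : Fin r ↪ Fin m) (γ : Fin r ↪ Fin n),
        (M.submatrix ρ γ).det = 0 ∧ (M.submatrix ρ γ).permanent = 0 := by
  classical
  have hn : 0 < n := Nat.pos_of_ne_zero (by rintro rfl; simp at hk)
  have hr : 1 ≤ r := by
    rcases Nat.eq_zero_or_pos r with rfl | h
    · simp at hk
    · exact h
  -- `k + 1 ≤ (r-1)·n` positions `(t / n, t % n)` in the first `r - 1` rows
  have hdiv : ∀ t : Fin (k + 1), t.val / n < r - 1 := fun t =>
    (Nat.div_lt_iff_lt_mul hn).2 (lt_of_le_of_lt (Nat.le_of_lt_succ t.2) hk)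
  let e : Fin (k + 1) → Fin m × Fin n := fun t =>
    (⟨t.val / n, lt_of_lt_of_le (hdiv t) (le_trans (Nat.sub_le r 1) hrm)⟩, ⟨t.val % n, Nat.mod_lt _ hn⟩)
  have he : Function.Injective e := by
    intro t t' h
    simp only [e, Prod.mk.injEq, Fin.mk.injEq] at h
    apply Fin.ext
    rw [← Nat.div_add_mod t.val n, ← Nat.div_add_mod t'.val n, h.1, h.2]
  let b : Fin (k + 1) → Matrix (Fin m) (Fin n) K := fun t => Matrix.stdBasis K (Fin m) (Fin n) (e t)
  have hb : LinearIndependent K b := (Matrix.stdBasis K (Fin m) (Fin n)).linearIndependent.comp e he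
  -- the subspace of matrices supported on the first `r - 1` rows
  let Z : Submodule K (Matrix (Fin m) (Fin n) K) :=
    { carrier := {M | ∀ i j, r - 1 ≤ i.val → M i j = 0}
      add_mem' := fun {M N} hM hN i j hi => by
        simp only [Set.mem_setOf_eq] at hM hN
        simp [hM i j hi, hN i j hi]
      zero_mem' := fun i j _ => rfl
      smul_mem' := fun c M hM i j hi => by
        simp only [Set.mem_setOf_eq] at hM
        simp [hM i j hi] }
  refine ⟨Submodule.span K (Set.range b), ?_, ?_⟩
  · rw [finrank_span_eq_card hb, Fintype.card_fin]
  · intro M hM ρ γ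
    have hMZ : M ∈ Z := by
      refine (Submodule.span_le.2 ?_) hM
      rintro _ ⟨t, rfl⟩ i j hi
      have hlt : ((e t).1).val < r - 1 := hdiv t
      have hne : (e t).1 ≠ i := by
        intro h
        rw [h] at hlt
        omega
      change Matrix.stdBasis K (Fin m) (Fin n) (e t) i j = 0
      rw [show e t = ((e t).1, (e t).2) from rfl, Matrix.stdBasis_eq_single]
      exact Matrix.single_apply_of_row_ne hne _ _ _
    -- an `r × r` row selection meets a row `≥ r - 1`
    obtain ⟨a, ha⟩ : ∃ a : Fin r, r - 1 ≤ (ρ a).val := by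
      by_contra hcon
      push Not at hcon
      have hinj : Function.Injective (fun a : Fin r => (⟨(ρ a).val, hcon a⟩ : Fin (r - 1))) := by
        intro a a' h
        have h' : (ρ a).val = (ρ a').val := by simpa using congrArg Fin.val h
        exact ρ.injective (Fin.ext h')
      have hcard := Fintype.card_le_of_injective _ hinj
      simp only [Fintype.card_fin] at hcard
      omega
    have hrow : ∀ j, (M.submatrix ρ γ) a j = 0 := fun j => hMZ (ρ a) (γ j) ha
    exact ⟨Matrix.det_eq_zero_of_row_eq_zero a hrow, permanent_eq_zero_of_row_eq_zero a hrow⟩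

/-- The "if" halves of `proposition26` as stated there (separately for minors and for permanents).
[cite: ChanIlten2015, Proposition 2.6 (proof)] -/
theorem proposition26_if {K : Type*} [Field K] {r m n k : ℕ} (hrm : r ≤ m) (hk : k < (r - 1) * n) :
    (∃ W : Submodule K (Matrix (Fin m) (Fin n) K), Module.finrank K W = k + 1 ∧
        ∀ M ∈ W, ∀ (ρ : Fin r ↪ Fin m) (γ : Fin r ↪ Fin n), (M.submatrix ρ γ).det = 0) ∧
    (∃ W : Submodule K (Matrix (Fin m) (Fin n) K), Module.finrank K W = k + 1 ∧
        ∀ M ∈ W, ∀ (ρ : Fin r ↪ Fin m) (γ : Fin r ↪ Fin n), (M.submatrix ρ γ).permanent = 0) := by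
  obtain ⟨W, hW, hWv⟩ := exists_subspace_of_lt (K := K) hrm hk
  exact ⟨⟨W, hW, fun M hM ρ γ => (hWv M hM ρ γ).1⟩, ⟨W, hW, fun M hM ρ γ => (hWv M hM ρ γ).2⟩⟩

end Literature.AlgebraicGeometry.DeterminantalHypersurfaces.ChanIlten

end
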